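import Summits.HodgeConjecture.HodgeCM.PerL34.FockHermite_1

/-! PORT of `HodgeCM/PerL34/FockHermite.lean` (HodgeCMPerL run 82) — part 2: continuation of `Summits.HodgeConjecture.HodgeCM.PerL34.FockHermite_1` (split at a top-level declaration boundary by port_pkg.py; scope re-opened below; declarations unchanged). -/

-- port_pkg: scope re-opened for this part (file-level context, then the namespace/section stack open at the cut)
set_option autoImplicit false
open MvPolynomial Complex
open scoped Real
namespace HodgeCM.PerL34.Fock.Hermite
noncomputable section
variable {σ : Type*}
section Bargmann
variable [Fintype σ] [DecidableEq σ]
/-- (Ported verbatim from the HodgeCMPerL package; no docstring in the source.) -/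
instance creAlg_comm : IsMulCommutative (creAlg σ) :=
  Algebra.isMulCommutative_adjoin ℂ (by
    rintro _ ⟨j, rfl⟩ _ ⟨k, rfl⟩
    exact opZs_comm j k)

open scoped IsMulCommutative in
/-- `F ↦ F(Z^*)`: the Fock-side polynomial ring `ℂ[z_σ]` acting on symbols through `z_j ↦ Z_j^*`
(Folland (1.73)/(1.75): `B⁻¹ A_j^* B = √π Z_j^*`, `A_j^* = √π z_j`, so `B⁻¹ z_j B = Z_j^*`). -/
def cre : MvPolynomial σ ℂ →ₐ[ℂ] creAlg σ :=
  MvPolynomial.aeval fun j => (⟨opZs j, Algebra.subset_adjoin ⟨j, rfl⟩⟩ : creAlg σ)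

open scoped IsMulCommutative in
/-- (Ported verbatim from the HodgeCMPerL package; no docstring in the source.) -/
@[simp] theorem cre_X (j : σ) : ((cre (X j) : creAlg σ) : Module.End ℂ (MvPolynomial σ ℂ)) = opZs j := by
  simp [cre]

open scoped IsMulCommutative in
/-- (Ported verbatim from the HodgeCMPerL package; no docstring in the source.) -/
theorem cre_mul (F G : MvPolynomial σ ℂ) :
    ((cre (F * G) : creAlg σ) : Module.End ℂ (MvPolynomial σ ℂ)) =
      ((cre F : creAlg σ) : Module.End ℂ (MvPolynomial σ ℂ)) * ((cre G : creAlg σ) : Module.End ℂ (MvPolynomial σ ℂ)) := by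
  rw [map_mul, Subalgebra.coe_mul]

open scoped IsMulCommutative in
/-- (Ported verbatim from the HodgeCMPerL package; no docstring in the source.) -/
theorem cre_add (F G : MvPolynomial σ ℂ) :
    ((cre (F + G) : creAlg σ) : Module.End ℂ (MvPolynomial σ ℂ)) =
      ((cre F : creAlg σ) : Module.End ℂ (MvPolynomial σ ℂ)) + ((cre G : creAlg σ) : Module.End ℂ (MvPolynomial σ ℂ)) := by
  rw [map_add, Subalgebra.coe_add]

open scoped IsMulCommutative in
/-- (Ported verbatim from the HodgeCMPerL package; no docstring in the source.) -/
theorem cre_C (a : ℂ) : ((cre (C a) : creAlg σ) : Module.End ℂ (MvPolynomial σ ℂ)) = a • (1 : Module.End ℂ _) := by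
  rw [cre, MvPolynomial.algHom_C, Subalgebra.coe_algebraMap, Algebra.algebraMap_eq_smul_one]

/-- Folland (1.72): `h_0 = B⁻¹ ζ_0 = 2^{n/4} e^{−π x²}`; its symbol is the constant `2^{n/4}`, `n = |σ|`. -/
def vacCoef (σ : Type*) [Fintype σ] : ℝ := (2 : ℝ) ^ ((Fintype.card σ : ℝ) / 4)

omit [DecidableEq σ] in
/-- (Ported verbatim from the HodgeCMPerL package; no docstring in the source.) -/
theorem vacCoef_pos : 0 < vacCoef σ := Real.rpow_pos_of_pos two_pos _

/-- The symbol of `h_0`. -/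
def vac (σ : Type*) [Fintype σ] : MvPolynomial σ ℂ := C (vacCoef σ : ℂ)

omit [DecidableEq σ] in
/-- (Ported verbatim from the HodgeCMPerL package; no docstring in the source.) -/
theorem pderiv_vac (j : σ) : pderiv j (vac σ) = 0 := pderiv_C

omit [DecidableEq σ] in
/-- The vacuum is annihilated: `Z_j h_0 = 0`. -/
theorem opZ_vac (j : σ) : opZ j (vac σ) = 0 := by
  rw [opZ_apply, pderiv_vac, smul_zero]

/-- **`B⁻¹` on polynomials**: `binv F = F(Z^*) h_0`, i.e. `B⁻¹ (F(A^*/√π) ζ_0)` in Folland's notation ((1.78):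
`ζ_α = (α!)^{-1/2} (A^*)^α ζ_0`). -/
def binv : MvPolynomial σ ℂ →ₗ[ℂ] MvPolynomial σ ℂ :=
  (LinearMap.applyₗ (vac σ)) ∘ₗ ((creAlg σ).val.toLinearMap ∘ₗ (cre (σ := σ)).toLinearMap)

/-- (Ported verbatim from the HodgeCMPerL package; no docstring in the source.) -/
theorem binv_apply (F : MvPolynomial σ ℂ) : binv F = (cre F : Module.End ℂ (MvPolynomial σ ℂ)) (vac σ) := rfl

/-- (Ported verbatim from the HodgeCMPerL package; no docstring in the source.) -/
@[simp] theorem binv_one : binv (1 : MvPolynomial σ ℂ) = vac σ := by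
  rw [binv_apply, map_one, Subalgebra.coe_one, Module.End.one_apply]

/-- (Ported verbatim from the HodgeCMPerL package; no docstring in the source.) -/
theorem binv_C (a : ℂ) : binv (C a : MvPolynomial σ ℂ) = a • vac σ := by
  rw [binv_apply, cre_C, LinearMap.smul_apply, Module.End.one_apply]

/-- **Dictionary, creation half** (Folland (1.73) with (1.75)): `B⁻¹ ∘ z_j = Z_j^* ∘ B⁻¹`. -/
theorem binv_X_mul (j : σ) (F : MvPolynomial σ ℂ) : binv (X j * F) = opZs j (binv F) := by
  rw [binv_apply, cre_mul, cre_X, Module.End.mul_apply, ← binv_apply]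

/-- **Dictionary, annihilation half** (Folland (1.73) with (1.74)): `B⁻¹ ∘ ∂/∂z_j = π Z_j ∘ B⁻¹`,
equivalently `Z_j (F(Z^*) h_0) = π⁻¹ (∂_j F)(Z^*) h_0` — Folland (1.80)(iv) `[Z_j, Z^{*α}] = π⁻¹ α_j Z^{*(α − 1_j)}`. -/
theorem opZ_binv (j : σ) (F : MvPolynomial σ ℂ) : opZ j (binv F) = (π : ℂ)⁻¹ • binv (pderiv j F) := by
  induction F using MvPolynomial.induction_on with
  | C a => rw [binv_C, map_smul, opZ_vac, smul_zero, pderiv_C, map_zero, smul_zero]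
  | add F G hF hG => rw [map_add, map_add, hF, hG, map_add, map_add, smul_add]
  | mul_X F k hF =>
      rw [mul_comm F (X k), binv_X_mul, opZ_opZs, hF, map_smul, pderiv_X_mul, map_add, ← binv_X_mul, smul_add]
      by_cases h : j = k
      · simp [h]
      · simp [h]

/-- **Uniqueness** (algebraic Stone–von Neumann, the half that is pure algebra): a linear map out of `ℂ[z_σ]` that
intertwines each `z_j` with `Z_j^*` is determined by its value on `1`. -/
theorem binv_unique (φ : MvPolynomial σ ℂ →ₗ[ℂ] MvPolynomial σ ℂ) (h1 : φ 1 = vac σ)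
    (hX : ∀ (j : σ) (F : MvPolynomial σ ℂ), φ (X j * F) = opZs j (φ F)) : φ = binv := by
  apply LinearMap.ext
  intro F
  induction F using MvPolynomial.induction_on with
  | C a => rw [show C a = a • (1 : MvPolynomial σ ℂ) by rw [smul_eq_C_mul, mul_one], map_smul, map_smul, h1,
      binv_one]
  | add F G hF hG => rw [map_add, map_add, hF, hG]
  | mul_X F k hF => rw [mul_comm, hX, binv_X_mul, hF]

/-- The Euler / number operator: `Z_j^* Z_j` is conjugate under `B⁻¹` to `π⁻¹ z_j ∂/∂z_j`
(Folland (1.77): `A_j^* A_j ζ_α = α_j ζ_α`). -/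
theorem opZs_opZ_binv (j : σ) (F : MvPolynomial σ ℂ) :
    opZs j (opZ j (binv F)) = (π : ℂ)⁻¹ • binv (X j * pderiv j F) := by
  rw [opZ_binv, map_smul, binv_X_mul]

end Bargmann

section Hermite

variable [Fintype σ] [DecidableEq σ]

/-- `|α| = Σ_j α_j`. -/
def mdeg (α : σ →₀ ℕ) : ℕ := ∑ j, α j

/-- `α! = Π_j α_j!`. -/
def mfact (α : σ →₀ ℕ) : ℕ := ∏ j, (α j).factorial

omit [DecidableEq σ] in
/-- (Ported verbatim from the HodgeCMPerL package; no docstring in the source.) -/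
theorem mfact_pos (α : σ →₀ ℕ) : 0 < mfact α :=
  Finset.prod_pos fun _ _ => Nat.factorial_pos _

/-- (Ported verbatim from the HodgeCMPerL package; no docstring in the source.) -/
theorem mdeg_add_single (α : σ →₀ ℕ) (j : σ) : mdeg (α + Finsupp.single j 1) = mdeg α + 1 := by
  simp [mdeg, Finsupp.add_apply, Finset.sum_add_distrib, Finsupp.single_apply, Finset.sum_ite_eq]

/-- (Ported verbatim from the HodgeCMPerL package; no docstring in the source.) -/
theorem mfact_add_single (α : σ →₀ ℕ) (j : σ) : mfact (α + Finsupp.single j 1) = mfact α * (α j + 1) := by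
  simp only [mfact]
  rw [← Finset.mul_prod_erase Finset.univ _ (Finset.mem_univ j),
    ← Finset.mul_prod_erase Finset.univ (fun i => (α i).factorial) (Finset.mem_univ j)]
  have h : ∀ i ∈ Finset.univ.erase j, ((α + Finsupp.single j 1 : σ →₀ ℕ) i).factorial = (α i).factorial := by
    intro i hi
    rw [Finsupp.add_apply, Finsupp.single_eq_of_ne (Finset.ne_of_mem_erase hi), add_zero]
  rw [Finset.prod_congr rfl h, Finsupp.add_apply, Finsupp.single_eq_same, Nat.factorial_succ]
  ring

/-- Folland's normalising constant `√(π^{|α|} / α!)` ((1.81), and `ζ_α = √(π^{|α|}/α!) z^α` in §1.6). -/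
def hcoef (α : σ →₀ ℕ) : ℝ := Real.sqrt (π ^ mdeg α / mfact α)

omit [DecidableEq σ] in
/-- (Ported verbatim from the HodgeCMPerL package; no docstring in the source.) -/
theorem hcoef_pos (α : σ →₀ ℕ) : 0 < hcoef α := by
  unfold hcoef
  apply Real.sqrt_pos.mpr
  exact div_pos (pow_pos Real.pi_pos _) (Nat.cast_pos.mpr (mfact_pos α))

/-- The key square-root identity behind (1.82): `√(π^{|α|}/α!) = √((α_j+1)/π) · √(π^{|α|+1}/(α+1_j)!)`. -/
theorem hcoef_step (α : σ →₀ ℕ) (j : σ) :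
    hcoef α = Real.sqrt ((α j + 1) / π) * hcoef (α + Finsupp.single j 1) := by
  unfold hcoef
  rw [mdeg_add_single, mfact_add_single, ← Real.sqrt_mul (by positivity)]
  congr 1
  have hπ := Real.pi_ne_zero
  have hf : (mfact α : ℝ) ≠ 0 := Nat.cast_ne_zero.mpr (mfact_pos α).ne'
  push_cast
  field_simp
  ring

/-- Folland §1.6: `ζ_α = √(π^{|α|}/α!) z^α`, the orthonormal monomial basis of Fock space. -/
def zeta (α : σ →₀ ℕ) : MvPolynomial σ ℂ := (hcoef α : ℂ) • monomial α 1

/-- **[Fo89 (1.81); chunk p0046 L17–L19] as a DEFINITION**: the (symbol of the) Hermite function `h_α := B⁻¹ ζ_α = √(π^{|α|}/α!) Z^{*α} h_0`.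
By construction `herm α` IS Folland's Hermite polynomial `H_α = e^{π x²} h_α` of (1.81)(ii). -/
def herm (α : σ →₀ ℕ) : MvPolynomial σ ℂ := binv (zeta α)

/-- (Ported verbatim from the HodgeCMPerL package; no docstring in the source.) -/
theorem herm_eq (α : σ →₀ ℕ) : herm α = (hcoef α : ℂ) • binv (monomial α 1) := by
  rw [herm, zeta, map_smul]

/-- (1.81) unfolded: `h_α = √(π^{|α|}/α!) · (z^α)(Z^*) h_0`, where `(z^α)(Z^*) = Π_j (Z_j^*)^{α_j}` (`cre`). -/
theorem herm_eq_cre (α : σ →₀ ℕ) :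
    herm α = (hcoef α : ℂ) • (cre (monomial α 1) : Module.End ℂ (MvPolynomial σ ℂ)) (vac σ) := by
  rw [herm_eq, binv_apply]

/-- `h_0`'s symbol is `2^{n/4}` (Folland (1.72)). -/
theorem herm_zero : herm (0 : σ →₀ ℕ) = vac σ := by
  rw [herm_eq]
  simp [hcoef, mdeg, mfact, binv_one]

omit [Fintype σ] [DecidableEq σ] in
/-- (Ported verbatim from the HodgeCMPerL package; no docstring in the source.) -/
theorem X_mul_monomial_one (j : σ) (α : σ →₀ ℕ) :
    X j * monomial α (1 : ℂ) = monomial (α + Finsupp.single j 1) 1 := by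
  rw [add_comm, monomial_single_add, pow_one]

/-- **[Fo89 (1.82); chunk p0046 L51], creation half**: `Z_j^* h_α = √((α_j + 1)/π) h_{α + 1_j}` (KERNEL). -/
theorem opZs_herm (j : σ) (α : σ →₀ ℕ) :
    opZs j (herm α) = (Real.sqrt ((α j + 1) / π) : ℂ) • herm (α + Finsupp.single j 1) := by
  rw [herm_eq, herm_eq, map_smul, ← binv_X_mul, X_mul_monomial_one, smul_smul, ← Complex.ofReal_mul,
    ← hcoef_step]

omit [Fintype σ] [DecidableEq σ] in
/-- The Euler identity `z_j ∂_j z^α = α_j z^α`. -/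
theorem X_mul_pderiv_monomial (j : σ) (α : σ →₀ ℕ) :
    X j * pderiv j (monomial α (1 : ℂ)) = (α j : ℂ) • monomial α 1 := by
  rw [pderiv_monomial, one_mul]
  by_cases h : α j = 0
  · simp [h]
  · rw [← pow_one (X j), ← monomial_single_add,
      add_tsub_cancel_of_le (Finsupp.single_le_iff.mpr (Nat.one_le_iff_ne_zero.mpr h)), smul_monomial,
      smul_eq_mul, mul_one]

/-- **Number operator** (Folland (1.77) `A_j^* A_j ζ_α = α_j ζ_α`, transported): `π Z_j^* Z_j h_α = α_j h_α`. -/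
theorem opZs_opZ_herm (j : σ) (α : σ →₀ ℕ) :
    opZs j (opZ j (herm α)) = ((α j : ℂ) * (π : ℂ)⁻¹) • herm α := by
  rw [herm_eq, map_smul, map_smul, opZs_opZ_binv, X_mul_pderiv_monomial, map_smul]
  module

/-- **[Fo89 (1.82); chunk p0046 L51], annihilation half**: `Z_j h_α = √(α_j/π) h_{α − 1_j}` (with `h_{α−1_j} = 0` when `α_j = 0`,
here automatic since the coefficient vanishes) (KERNEL). -/
theorem opZ_herm (j : σ) (α : σ →₀ ℕ) :
    opZ j (herm α) = (Real.sqrt (α j / π) : ℂ) • herm (α - Finsupp.single j 1) := by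
  by_cases h : α j = 0
  · -- `Z_j h_α = 0` when `α_j = 0`
    rw [h, Nat.cast_zero, zero_div, Real.sqrt_zero, Complex.ofReal_zero, zero_smul, herm_eq, map_smul, opZ_binv,
      pderiv_monomial, h, Nat.cast_zero, mul_zero, monomial_zero, map_zero, smul_zero, smul_zero]
  · -- write `α = (α − 1_j) + 1_j`, `α_j = m + 1`
    have hle : Finsupp.single j 1 ≤ α := Finsupp.single_le_iff.mpr (Nat.one_le_iff_ne_zero.mpr h)
    obtain ⟨m, hm⟩ : ∃ m, α j = m + 1 := Nat.exists_eq_succ_of_ne_zero h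
    have hα : α - Finsupp.single j 1 + Finsupp.single j 1 = α := tsub_add_cancel_of_le hle
    have hβj : (α - Finsupp.single j 1 : σ →₀ ℕ) j = m := by
      rw [Finsupp.tsub_apply, Finsupp.single_eq_same, hm, Nat.add_sub_cancel]
    -- (1.82)-creation for `α − 1_j`: `Z_j^* h_{α−1_j} = √((m+1)/π) h_α`
    have hcre := opZs_herm j (α - Finsupp.single j 1)
    rw [hα, hβj] at hcre
    set s : ℂ := (Real.sqrt (((m : ℝ) + 1) / π) : ℂ) with hs_def
    have hs2 : s * s = ((m : ℂ) + 1) * (π : ℂ)⁻¹ := by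
      rw [hs_def, ← Complex.ofReal_mul, Real.mul_self_sqrt (by positivity)]
      push_cast
      ring
    have hs : s ≠ 0 := by
      intro h0
      rw [h0, zero_mul] at hs2
      exact mul_ne_zero (Nat.cast_add_one_ne_zero m) (inv_ne_zero pi_ne_zero') hs2.symm
    -- `Z_j h_α = s⁻¹ Z_j Z_j^* h_{α−1_j} = s⁻¹ (Z_j^* Z_j + π⁻¹) h_{α−1_j} = s⁻¹ (m/π + 1/π) h_{α−1_j}`
    have key : opZ j (herm α) = s⁻¹ • opZ j (opZs j (herm (α - Finsupp.single j 1))) := by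
      rw [hcre, map_smul, smul_smul, inv_mul_cancel₀ hs, one_smul]
    rw [key, opZ_opZs, if_pos rfl, opZs_opZ_herm, hβj, ← add_smul, smul_smul, hm]
    congr 1
    push_cast
    rw [show ((m : ℂ) * (π : ℂ)⁻¹ + (π : ℂ)⁻¹) = s * s by rw [hs2]; ring, ← mul_assoc, inv_mul_cancel₀ hs,
      one_mul]

end Hermite

section HermiteOperator

variable [Fintype σ] [DecidableEq σ]

/-- (Ported verbatim from the HodgeCMPerL package; no docstring in the source.) -/
theorem inv_two_pi_I : (2 * π * I : ℂ)⁻¹ = -I * (2 * π : ℂ)⁻¹ := by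
  have hπ := pi_ne_zero'
  have hI := I_ne_zero
  field_simp
  ring_nf
  rw [I_sq]
  ring

omit [Fintype σ] [DecidableEq σ] in
/-- `D_j` on symbols without `i` in the denominator: `D_j p = −i(2π)⁻¹ ∂_j p + i x_j p`. -/
theorem opD_apply (j : σ) (p : MvPolynomial σ ℂ) :
    opD j p = (-I * (2 * π : ℂ)⁻¹) • pderiv j p + I • (X j * p) := by
  simp only [opD, opDel, LinearMap.smul_apply, LinearMap.sub_apply, opPd_apply, opX_apply, inv_two_pi_I, smul_sub,
    smul_smul]
  have hπ := two_pi_ne_zero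
  match_scalars <;> field_simp

/-- Folland's **Hermite operator** `2π(D_j² + X_j²)` ([Fo89 §1.7 (vi); chunk p0047 L3–L7]), on symbols. -/
def hermiteOp (j : σ) : Module.End ℂ (MvPolynomial σ ℂ) := (2 * π : ℂ) • (opD j * opD j + opX j * opX j)

omit [Fintype σ] in
/-- **[Fo89 §1.7 (vi); chunk p0047 L1]** in the normally-ordered form `2π(D_j² + X_j²) = 2π Z_j^* Z_j + 1`
(KERNEL, on symbols; Folland's literal form `= 2π Z_j Z_j^* − 1` is `hermiteOp_apply'`). -/
theorem hermiteOp_apply (j : σ) (p : MvPolynomial σ ℂ) :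
    hermiteOp j p = (2 * π : ℂ) • opZs j (opZ j p) + p := by
  simp only [hermiteOp, LinearMap.smul_apply, LinearMap.add_apply, Module.End.mul_apply, opX_apply, opD_apply,
    opZ_apply, opZs_apply, map_add, map_smul, smul_add, smul_sub, pderiv_X_mul, if_true, smul_smul]
  have hπ := pi_ne_zero'
  match_scalars <;> (ring_nf; (try simp only [I_sq]); (try field_simp); (try ring_nf))

omit [Fintype σ] in
/-- **[Fo89 §1.7 (vi); chunk p0047 L1, L9] literally: `2π(D_j² + X_j²) = 2π Z_j Z_j^* − 1`** (KERNEL, on symbols). -/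
theorem hermiteOp_apply' (j : σ) (p : MvPolynomial σ ℂ) :
    hermiteOp j p = (2 * π : ℂ) • opZ j (opZs j p) - p := by
  have hπ := pi_ne_zero'
  rw [hermiteOp_apply, opZ_opZs, if_pos rfl, smul_add, smul_smul,
    show (2 * π : ℂ) * (π : ℂ)⁻¹ = 2 by field_simp]
  module

/-- **[Fo89 (1.83a); chunk p0047 L14] "`2π(D_j² + X_j²) h_α = (2α_j + 1) h_α`"** — the Hermite functions are joint
eigenfunctions of the Hermite operators (KERNEL). -/
theorem hermiteOp_herm (j : σ) (α : σ →₀ ℕ) : hermiteOp j (herm α) = (2 * (α j : ℂ) + 1) • herm α := by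
  rw [hermiteOp_apply, opZs_opZ_herm, smul_smul]
  have hπ := pi_ne_zero'
  match_scalars
  field_simp

/-- **[Fo89 (1.83b); chunk p0047 L19] "`2π(D² + X²) h_α = (2|α| + n) h_α`"**, `n = |σ|` (KERNEL). -/
theorem hermiteOp_sum_herm (α : σ →₀ ℕ) :
    (∑ j, hermiteOp j) (herm α) = (2 * (mdeg α : ℂ) + Fintype.card σ) • herm α := by
  rw [LinearMap.sum_apply]
  simp only [hermiteOp_herm]
  rw [← Finset.sum_smul]
  congr 1
  rw [Finset.sum_add_distrib, ← Finset.mul_sum, Finset.sum_const, Finset.card_univ, nsmul_eq_mul, mul_one, mdeg]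
  push_cast
  ring

end HermiteOperator

section Triangular

variable [Fintype σ] [DecidableEq σ]

/-- Polynomials all of whose monomials have total degree `< m`. -/
def degLT (m : ℕ) : Submodule ℂ (MvPolynomial σ ℂ) := restrictSupport ℂ {β : σ →₀ ℕ | mdeg β < m}

omit [DecidableEq σ] in
/-- (Ported verbatim from the HodgeCMPerL package; no docstring in the source.) -/
theorem mem_degLT {m : ℕ} {p : MvPolynomial σ ℂ} : p ∈ degLT m ↔ ∀ β ∈ p.support, mdeg β < m := by
  rw [degLT, mem_restrictSupport_iff]
  exact Iff.rfl

omit [DecidableEq σ] in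
/-- (Ported verbatim from the HodgeCMPerL package; no docstring in the source.) -/
theorem degLT_mono {m n : ℕ} (h : m ≤ n) : degLT (σ := σ) m ≤ degLT n :=
  fun _ hp => mem_degLT.mpr fun β hβ => lt_of_lt_of_le (mem_degLT.mp hp β hβ) h

omit [DecidableEq σ] in
/-- (Ported verbatim from the HodgeCMPerL package; no docstring in the source.) -/
theorem monomial_mem_degLT {m : ℕ} {β : σ →₀ ℕ} (c : ℂ) (h : mdeg β < m) :
    (monomial β c : MvPolynomial σ ℂ) ∈ degLT m :=
  mem_degLT.mpr fun γ hγ => by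
    rw [Finset.mem_singleton.mp (support_monomial_subset hγ)]
    exact h

/-- (Ported verbatim from the HodgeCMPerL package; no docstring in the source.) -/
theorem mdeg_single_add (β : σ →₀ ℕ) (j : σ) : mdeg (Finsupp.single j 1 + β) = mdeg β + 1 := by
  rw [add_comm, mdeg_add_single]

/-- (Ported verbatim from the HodgeCMPerL package; no docstring in the source.) -/
theorem X_mul_mem_degLT {m : ℕ} (j : σ) {p : MvPolynomial σ ℂ} (hp : p ∈ degLT m) :
    X j * p ∈ degLT (m + 1) := by
  rw [mem_degLT] at hp ⊢
  intro γ hγ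
  rw [support_X_mul, Finset.mem_map] at hγ
  obtain ⟨β, hβ, rfl⟩ := hγ
  rw [addLeftEmbedding_apply, mdeg_single_add]
  exact Nat.succ_lt_succ (hp β hβ)

/-- (Ported verbatim from the HodgeCMPerL package; no docstring in the source.) -/
theorem pderiv_mem_degLT {m : ℕ} (j : σ) {p : MvPolynomial σ ℂ} (hp : p ∈ degLT m) :
    pderiv j p ∈ degLT m := by
  rw [mem_degLT] at hp ⊢
  intro γ hγ
  rw [mem_support_iff, coeff_pderiv] at hγ
  have h1 : coeff (γ + Finsupp.single j 1) p ≠ 0 := fun h => hγ (by rw [h, zero_mul])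
  have h2 := hp _ (mem_support_iff.mpr h1)
  rw [mdeg_add_single] at h2
  omega

/-- (Ported verbatim from the HodgeCMPerL package; no docstring in the source.) -/
theorem opZs_mem_degLT {m : ℕ} (j : σ) {p : MvPolynomial σ ℂ} (hp : p ∈ degLT m) :
    opZs j p ∈ degLT (m + 1) := by
  rw [opZs_apply]
  exact sub_mem (Submodule.smul_mem _ _ (X_mul_mem_degLT j hp))
    (Submodule.smul_mem _ _ (degLT_mono (Nat.le_succ m) (pderiv_mem_degLT j hp)))

omit [DecidableEq σ] in
/-- (Ported verbatim from the HodgeCMPerL package; no docstring in the source.) -/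
theorem mdeg_tsub_le (β : σ →₀ ℕ) (j : σ) : mdeg (β - Finsupp.single j 1) ≤ mdeg β :=
  Finset.sum_le_sum fun i _ => by
    rw [Finsupp.tsub_apply]
    exact tsub_le_self


-- port_pkg: scope closed for this part
end Triangular
end
end HodgeCM.PerL34.Fock.Hermite
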